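import Summits.Ventures.PercRepro.ProfilePointedCircuitClassesTwelveCaptureA

/-!
# PercRepro — THE CAPTURE REDUCTION OF THE TWELVE-POINT STATEMENT
(p5, gen 45; `proofs/P5-GM1.md` §67)

From the capture identity of ProfilePointedCircuitClassesTwelveCaptureA,
`out_6(e) + d_a + δ = in_5(e) + u_a + (u₂ + y)`, and the `n = 10` theorem `d_a ≤ u_a`
(`inOutBottomFour_holds` on `N ／ a ∖ a'`, transferred as in TwelveSeriesB), the twelve-point statement at a
point `e` avoided by a series pair `{a, a'}` follows from the CAPTURE INEQUALITY
  (C)  `#{W ∈ BI_5 : e ∈ W, a ∈ W, ρ(W + a') = 5} ≤ #{S ∈ BI_6 : e ∉ S, a ∈ S, ρ(S + a') = 6}`,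
the in–out inequality restricted to the sets whose closure contains the cocircuit `{a, a'}`.  Nothing here
asserts (C) (a conjecture; census in §67).
-/

open scoped Matroid

namespace PercRepro.Cogirth

open Finset ThmH Skew Shadow Profile

variable {α : Type} [DecidableEq α] {N : Matroid α} [N.Finite]

section TwelveCaptureB

/-! ### The capture reduction -/

/-- **THE CAPTURE REDUCTION OF THE TWELVE-POINT STATEMENT**: on `#E = 12`, `ρ(E) = 7`, with a series pair
`{a, a'}` avoiding `e`, the inequality `in_5(e) ≤ out_6(e)` follows from
  (C)  `#{W ∈ BI_5 : e ∈ W, a ∈ W, ρ(W + a') = 5} ≤ #{S ∈ BI_6 : e ∉ S, a ∈ S, ρ(S + a') = 6}`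
— the demands through `a` whose closure contains `a'` are at most the units through `a` whose closure contains `a'`
(those containing `a'` included).  Proof: the capture identity `outCount_six_add_eq_of_seriesPair` and the
`n = 10` theorem `d_a ≤ u_a` (`inOutBottomFour_holds` on `N ／ a ∖ a'`, transferred as in TwelveSeriesB). -/
theorem inCount_five_le_outCount_six_of_seriesPair_of_capture {a a' e : α} (hn : (gr N).card = 12)
    (hR : rk N (gr N) = 7) (h : SeriesPair N a a') (he : e ∈ gr N) (hea : e ≠ a) (hea' : e ≠ a')
    (hcap : ((biIndepSets N 5).filter (fun W => (e ∈ W ∧ a ∈ W) ∧ rk N (insert a' W) = 5)).card ≤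
      ((biIndepSets N 6).filter (fun S => (e ∉ S ∧ a ∈ S) ∧ rk N (insert a' S) = 6)).card) :
    inCount N 5 e ≤ outCount N 6 e := by
  have hid := outCount_six_add_eq_of_seriesPair hn hR h he hea hea'
  have ha : a ∈ gr N := h.1
  have ha' : a' ∈ gr N := h.2.1
  have hne : a ≠ a' := h.2.2.1
  have hIa : ∀ W : Finset α, e ∉ insert a W ↔ e ∉ W := by
    intro W
    rw [mem_insert, not_or]
    exact ⟨fun h' => h'.2, fun h' => ⟨hea, h'⟩⟩
  have hIa' : ∀ W : Finset α, e ∈ insert a' W ↔ e ∈ W := by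
    intro W
    rw [mem_insert]
    exact ⟨fun h' => h'.resolve_left hea', fun h' => Or.inr h'⟩
  have hPe : ∀ W : Finset α, e ∈ insert a' (W.erase a) ↔ e ∈ W := by
    intro W
    rw [mem_insert, mem_erase]
    constructor
    · rintro (h' | ⟨_, h'⟩)
      · exact absurd h' hea'
      · exact h'
    · intro h'
      exact Or.inr ⟨hea, h'⟩
  have hPe' : ∀ W : Finset α, e ∈ insert a (W.erase a') ↔ e ∈ W := by
    intro W
    rw [mem_insert, mem_erase]
    constructor
    · rintro (h' | ⟨_, h'⟩)
      · exact absurd h' hea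
      · exact h'
    · intro h'
      exact Or.inr ⟨hea', h'⟩
  -- the `10`-point minor: `d_{a'} ≤ u_a`, and `d_a = d_{a'}` by the swap
  have hN₁n := card_gr_minor_add_two_of_seriesPair h
  have hN₁r := rk_gr_minor_add_one_of_seriesPair h
  have he₁ : e ∈ gr ((N ／ ({a} : Set α)) ＼ ({a'} : Set α)) := by
    rw [gr_minor_of_seriesPair]
    exact mem_erase.2 ⟨hea', mem_erase.2 ⟨hea, he⟩⟩
  have h10 := inOutBottomFour_holds (α := α) ((N ／ ({a} : Set α)) ＼ ({a'} : Set α)) e he₁ (by omega) (by omega)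
  unfold inCount outCount at h10
  rw [card_filter_minor_insert_right_eq_of_seriesPair h 4 (fun Y => e ∈ Y) hIa',
    card_filter_minor_insert_left_eq_of_seriesPair h 5 (fun Y => e ∉ Y) hIa] at h10
  simp only [Nat.reduceAdd] at h10
  have hD1 := card_filter_swap_of_seriesPair h 5 (fun W => e ∈ W) hPe hPe'
  omega

end TwelveCaptureB

end PercRepro.Cogirth
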